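import Literature.NumberTheory.EllipticCurves.TwoIsogenyTorsorImage
import Literature.NumberTheory.EllipticCurves.TwoIsogenyDescent
import Literature.NumberTheory.EllipticCurves.VariableChangePointsMap
import HarnessLib

/-!
# The dual of the explicit `2`-isogeny and the second explicit `2`-isogeny have the same kernel on `H¹`
# (Silverman, *AEC*, III.4.5 and III.6.1–6.2: `φ̂ ∘ φ = [2]`, `E'' ≅ E`)

For `V : y² = x³ + ax² + bx` in two-torsion normal form over a field `K` of characteristic `0`,
`φ = φ_V : V → V'` the explicit `2`-isogeny (`twoIsogenyGeomHom`) and `φ_{V'} : V' → V''` the explicit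
`2`-isogeny of `V'`, any `Γ_K`-equivariant homomorphism `ψ : V'(K̄) → V(K̄)` with `ψ ∘ φ = [2]` (e.g. the
dual isogeny `φ̂`) satisfies `φ_{V'} = s ∘ ψ` for the scaling isomorphism `s : V(K̄) → V''(K̄)`,
`(x, y) ↦ (4x, 8y)` (both sides agree after `φ`, which is onto `V'(K̄)`: Silverman, *AEC*, III.4.5,
"`E₁ → E₂ → E₁` is multiplication by `2`" up to `E₃ ≅ E₁`), and `ψ(T') = O`. Consequently

  **`ker (ψ_* : H¹(K, V') → H¹(K, V)) = ker ((φ_{V'})_* : H¹(K, V') → H¹(K, V''))`**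

(`= im Ξ_{V'}`, `range_twoIsogenyTorsorHom_eq_ker_galH1Map`), and the same for the kernels on `Ш` over a
number field. This identifies the factor `#Ш(E)[φ_E]` of the tree's Selmer count
(`two_pow_twoIsogenySelmerRank_add_eq`) with `#ker Ш(φ̂₀)` for the dual of `φ₀ : V₀ → E`, which is what
the Cassels–Tate adjointness `⟨φ₀ x, y⟩ = ⟨x, φ̂₀ y⟩` speaks about.

* `WeierstrassCurve.twoIsogenyFun_congrEquiv` — transport of `twoIsogenyFun` along an equality of curves.
* `WeierstrassCurve.exists_scaleGeomHom` — the equivariant scaling `s : V(K̄) →+ V''(K̄)`,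
  `(x, y) ↦ (4x, 8y)`.
* `WeierstrassCurve.exists_twoIsogenyGeomHom_twoIsogenyGeomHom` — `φ_{V'} (φ_V P) = s (2 • P)`.
* `WeierstrassCurve.exists_twoIsogenyGeomHom_eq_comp` — `φ_{V'} = s ∘ ψ` when `ψ ∘ φ_V = [2]`.
* `WeierstrassCurve.apply_geomTwoTorsionPoint_eq_zero_of_comp` — `ψ (T') = O`.
* `WeierstrassCurve.galH1Map_twoIsogenyTorsorClass_eq_zero_of_comp` — `ψ_* ξ_d = 0`.
* `WeierstrassCurve.ker_galH1Map_eq_of_comp_twoIsogeny` — the kernel identity on `H¹(K, V')`.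
* `WeierstrassCurve.ker_shaMap_eq_of_comp_twoIsogeny` — the kernel identity on `Ш(V'/K)`.

## References

* J. H. Silverman, *The Arithmetic of Elliptic Curves*, 2nd ed., GTM 106 (2009), III.4.5, III.6.1,
  III.6.2, X.4.2(a), X.4.9. [SilvermanAEC2009]

## Design

Theorems only (the scaling map is built inside `exists_scaleGeomHom` from the tree's
`VariableChange.pointEquiv` with `u = 2⁻¹` over `K̄` and `Affine.Point.congrEquiv`); no named facts.
Same conventions as `TwoIsogenyTorsorImage.lean`.
-/

noncomputable section

open scoped Classical

universe u

namespace WeierstrassCurve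

open Literature.NumberTheory.EllipticCurves Literature.NumberTheory.EllipticCurves.TwoIsogenyTorsor
open Literature.NumberTheory.GaloisRepresentations
open _root_.WeierstrassCurve.Affine (SqUnits sqClass sqClass_of_ne_zero)

/-! ## Transport of the explicit `2`-isogeny along an equality of curves -/

section Transport

variable {F : Type u} [Field F]

/-- `twoIsogenyFun` commutes with the transport `congrEquiv` along an equality of Weierstrass
equations (both in two-torsion normal form and elliptic). [folklore] -/
theorem twoIsogenyFun_congrEquiv {X Y : WeierstrassCurve F} [X.IsTwoTorsionNF] [X.IsElliptic]
    [Y.IsTwoTorsionNF] [Y.IsElliptic] (h : X = Y) (P : X.toAffine.Point) :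
    Y.twoIsogenyFun (Affine.Point.congrEquiv h P) =
      Affine.Point.congrEquiv (congrArg twoIsogenyCodomain h) (X.twoIsogenyFun P) := by
  subst h
  rfl

end Transport

/-! ## The scaling isomorphism `s : V(K̄) → V''(K̄)`, `(x, y) ↦ (4x, 8y)` -/

section Scale

variable {K : Type u} [Field K] [CharZero K] (V : WeierstrassCurve K) [V.IsTwoTorsionNF] [V.IsElliptic]

/-- **The scaling isomorphism `s : V(K̄) →+ V''(K̄)`, `(x, y) ↦ (4x, 8y)`** (Silverman, *AEC*,
III.4.5: `E₃ ≅ E₁`), as a `Γ_K`-equivariant homomorphism of geometric points: the tree's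
`VariableChange.pointEquiv` for `u = 1/2` over `K̄` followed by the transport along
`(1/2) • (V ⊗ K̄) = V'' ⊗ K̄` (`a₂'' = 4a₂`, `a₄'' = 16a₄`). Stated as an existence to keep this file
definition-free. [folklore] -/
theorem exists_scaleGeomHom :
    ∃ s : V.geomPoints →+ V.twoIsogenyCodomain.twoIsogenyCodomain.geomPoints,
      (∀ (σ : Field.absoluteGaloisGroup K) (P : V.geomPoints), s (σ • P) = σ • s P) ∧
      ∀ {x y : AlgebraicClosure K} (h : (V.baseChange (AlgebraicClosure K)).toAffine.Nonsingular x y),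
        ∃ h', s (Affine.Point.some x y h) =
          (Affine.Point.some (4 * x) (8 * y) h' : V.twoIsogenyCodomain.twoIsogenyCodomain.geomPoints) := by
  have h2 : (2 : AlgebraicClosure K) ≠ 0 := by exact_mod_cast two_ne_zero' V
  -- the change of variables `u = 1/2`, `r = s = t = 0` over `K̄`
  set C : VariableChange (AlgebraicClosure K) := ⟨(Units.mk0 (2 : AlgebraicClosure K) h2)⁻¹, 0, 0, 0⟩
    with hC
  have hCX : ∀ x : AlgebraicClosure K, C.toX x = 4 * x := fun x ↦ by
    simp only [VariableChange.toX_def, hC, inv_inv, Units.val_mk0, sub_zero]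
    norm_num
  have hCY : ∀ x y : AlgebraicClosure K, C.toY x y = 8 * y := fun x y ↦ by
    simp only [VariableChange.toY, hC, inv_inv, Units.val_mk0, sub_zero, zero_mul]
    norm_num
  have hCW : C • V.baseChange (AlgebraicClosure K) =
      V.twoIsogenyCodomain.twoIsogenyCodomain.baseChange (AlgebraicClosure K) := by
    simp only [twoIsogenyCodomain, baseChange, map, variableChange_def, hC,
      a₁_of_isTwoTorsionNF, a₃_of_isTwoTorsionNF, a₆_of_isTwoTorsionNF]
    ext <;> simp [map_ofNat] <;> ring
  set s : V.geomPoints →+ V.twoIsogenyCodomain.twoIsogenyCodomain.geomPoints :=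
    ((Affine.Point.congrEquiv hCW).toAddMonoidHom).comp
      (VariableChange.pointEquiv (V.baseChange (AlgebraicClosure K)) C).toAddMonoidHom with hs
  -- the formula on affine points
  have hsome : ∀ {x y : AlgebraicClosure K}
      (h : (V.baseChange (AlgebraicClosure K)).toAffine.Nonsingular x y),
      ∃ h', s (Affine.Point.some x y h) =
        (Affine.Point.some (4 * x) (8 * y) h' : V.twoIsogenyCodomain.twoIsogenyCodomain.geomPoints) := by
    intro x y h
    have e : s (Affine.Point.some x y h) = Affine.Point.congrEquiv hCW
        (.some (C.toX x) (C.toY x y) ((VariableChange.nonsingular_iff _ C x y).mpr h)) := rfl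
    rw [e, Affine.Point.congrEquiv_some]
    exact some_eq_some_of_eq _ (hCX x) (hCY x y)
  refine ⟨s, fun σ P ↦ ?_, hsome⟩
  -- equivariance: the coefficients `4, 8` are rational
  rcases P with _ | ⟨x, y, h⟩
  · change s (σ • (0 : V.geomPoints)) = σ • s 0
    rw [smul_zero, map_zero, smul_zero]
  · obtain ⟨h₁, e₁⟩ := hsome h
    have hσ := V.nonsingular_galAut σ h
    rw [V.smul_geomPoints_some σ h hσ]
    obtain ⟨h₂, e₂⟩ := hsome hσ
    rw [e₂, e₁, V.twoIsogenyCodomain.twoIsogenyCodomain.smul_geomPoints_some σ h₁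
      (V.twoIsogenyCodomain.twoIsogenyCodomain.nonsingular_galAut σ h₁)]
    obtain ⟨h₃, e₃⟩ := some_eq_some_of_eq (V := V.twoIsogenyCodomain.twoIsogenyCodomain.baseChange
      (AlgebraicClosure K)) h₂ (x' := galAut K σ (4 * x)) (y' := galAut K σ (8 * y))
      (by rw [map_mul, map_ofNat]) (by rw [map_mul, map_ofNat])
    exact e₃

/-! ## `φ_{V'} ∘ φ_V = s ∘ [2]` and `φ_{V'} = s ∘ ψ` -/

/-- **`φ_{V'} (φ_V P) = s (2P)`** on geometric points for an equivariant homomorphism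
`s : V(K̄) → V''(K̄)` — the scaling `(x, y) ↦ (4x, 8y)` (Silverman, *AEC*, III.4.5: the composite of
the two explicit `2`-isogenies is `[2]` followed by `E₁ ≅ E₃`; the tree's coordinate statement
`twoIsogenyFun_twoIsogenyFun`, transported to `K̄`-points). [cite: SilvermanAEC2009, III.4 Example 4.5] -/
theorem exists_twoIsogenyGeomHom_twoIsogenyGeomHom :
    ∃ s : V.geomPoints →+ V.twoIsogenyCodomain.twoIsogenyCodomain.geomPoints,
      (∀ (σ : Field.absoluteGaloisGroup K) (P : V.geomPoints), s (σ • P) = σ • s P) ∧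
      ∀ P : V.geomPoints,
        V.twoIsogenyCodomain.twoIsogenyGeomHom (V.twoIsogenyGeomHom P) = s (2 • P) := by
  obtain ⟨s, hs, hsome⟩ := exists_scaleGeomHom V
  refine ⟨s, hs, fun P ↦ ?_⟩
  have h₁ := twoIsogenyCodomain_baseChange V (AlgebraicClosure K)
  have h₂ := twoIsogenyCodomain_baseChange V.twoIsogenyCodomain (AlgebraicClosure K)
  change Affine.Point.congrEquiv h₂ ((V.twoIsogenyCodomain.baseChange (AlgebraicClosure K)).twoIsogenyFun
    (Affine.Point.congrEquiv h₁ ((V.baseChange (AlgebraicClosure K)).twoIsogenyFun P))) = _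
  rw [twoIsogenyFun_congrEquiv h₁]
  rcases twoIsogenyFun_twoIsogenyFun (V.baseChange (AlgebraicClosure K)) P with
    ⟨h2P, h0⟩ | ⟨x', y', h', h2P, hval⟩
  · have h2P' : (2 • P : V.geomPoints) = 0 := h2P
    rw [h0, Affine.Point.congrEquiv_zero, Affine.Point.congrEquiv_zero, h2P', map_zero]
    rfl
  · have h2P' : (2 • P : V.geomPoints) = Affine.Point.some x' y' h' := h2P
    obtain ⟨h₃, e₃⟩ := hsome h'
    rw [hval, Affine.Point.congrEquiv_some, Affine.Point.congrEquiv_some, h2P', e₃]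

variable {V} in
/-- **`φ_{V'} = s ∘ ψ` whenever `ψ ∘ φ_V = [2]`** (e.g. for the dual isogeny `ψ = φ̂_V`), for an
equivariant `s : V(K̄) → V''(K̄)`: both sides agree on `φ_V(P)` by
`exists_twoIsogenyGeomHom_twoIsogenyGeomHom`, and `φ_V` is onto `V'(K̄)` (`twoIsogenyGeomHom_surjective`).
Silverman, *AEC*, III.4.5, III.6.1. [folklore] -/
theorem exists_twoIsogenyGeomHom_eq_comp (ψ : V.twoIsogenyCodomain.geomPoints →+ V.geomPoints)
    (hψ : ∀ P : V.geomPoints, ψ (V.twoIsogenyGeomHom P) = 2 • P) :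
    ∃ s : V.geomPoints →+ V.twoIsogenyCodomain.twoIsogenyCodomain.geomPoints,
      (∀ (σ : Field.absoluteGaloisGroup K) (P : V.geomPoints), s (σ • P) = σ • s P) ∧
      V.twoIsogenyCodomain.twoIsogenyGeomHom = s.comp ψ := by
  obtain ⟨s, hs, hcomp⟩ := exists_twoIsogenyGeomHom_twoIsogenyGeomHom V
  refine ⟨s, hs, AddMonoidHom.ext fun Q ↦ ?_⟩
  obtain ⟨P, rfl⟩ := V.twoIsogenyGeomHom_surjective Q
  rw [AddMonoidHom.comp_apply, hψ, hcomp]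

/-! ## `ψ(T') = O` -/

omit [CharZero K] in
variable {V} in
/-- **`ψ (T') = O` whenever `ψ ∘ φ_V = [2]`**: `T' = (0,0) ∈ V'(K̄)` is `φ_V (x₀, 0)` for a root `x₀`
of `x² + ax + b` (the abscissa of `φ_V (x₀, 0)` is `(x₀² + ax₀ + b)/x₀ = 0`), and `(x₀, 0)` has order `2`.
Silverman, *AEC*, III.4.5 (`ker φ̂ = φ(E[2])`). [folklore] -/
theorem apply_geomTwoTorsionPoint_eq_zero_of_comp (ψ : V.twoIsogenyCodomain.geomPoints →+ V.geomPoints)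
    (hψ : ∀ P : V.geomPoints, ψ (V.twoIsogenyGeomHom P) = 2 • P) :
    ψ V.twoIsogenyCodomain.geomTwoTorsionPoint = 0 := by
  set W := V.baseChange (AlgebraicClosure K) with hW
  -- a root `x₀` of `x² + a x + b` over `K̄`
  obtain ⟨x₀, hx₀⟩ : ∃ x₀ : AlgebraicClosure K, x₀ ^ 2 + W.a₂ * x₀ + W.a₄ = 0 := by
    obtain ⟨x₀, hx₀⟩ := IsAlgClosed.exists_root
      (Polynomial.C 1 * Polynomial.X ^ 2 + Polynomial.C W.a₂ * Polynomial.X + Polynomial.C W.a₄ :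
        Polynomial (AlgebraicClosure K)) (by
        rw [Polynomial.degree_quadratic (one_ne_zero' (AlgebraicClosure K))]; decide)
    exact ⟨x₀, by simpa [Polynomial.IsRoot] using hx₀⟩
  have hx₀0 : x₀ ≠ 0 := by
    rintro rfl
    exact a₄_ne_zero W (by simpa using hx₀)
  have heq : W.toAffine.Equation x₀ 0 := by
    rw [equation_iff_of_isTwoTorsionNF]
    linear_combination (-x₀) * hx₀
  have hns : W.toAffine.Nonsingular x₀ 0 := Affine.equation_iff_nonsingular.mp heq
  set P₂ : V.geomPoints := Affine.Point.some x₀ 0 hns with hP₂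
  -- `φ_V (x₀, 0) = T'`
  have hφ : V.twoIsogenyGeomHom P₂ = V.twoIsogenyCodomain.geomTwoTorsionPoint := by
    obtain ⟨h', e'⟩ := V.twoIsogenyGeomHom_some hns hx₀0
    rw [hP₂, e']
    have hX : W.twoIsogenyX x₀ = 0 := by
      rw [twoIsogenyX, hx₀, zero_div]
    have hY : W.twoIsogenyY x₀ 0 = 0 := by
      rw [twoIsogenyY, zero_mul, zero_div]
    obtain ⟨h'', e''⟩ := some_eq_some_of_eq h' hX hY
    exact e''
  -- `(x₀, 0)` has order `2`
  have h2 : (2 • P₂ : V.geomPoints) = 0 := by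
    rw [two_nsmul, add_eq_zero_iff_eq_neg, hP₂]
    change (Affine.Point.some x₀ 0 hns : W.toAffine.Point) = -Affine.Point.some x₀ 0 hns
    rw [Affine.Point.neg_some]
    obtain ⟨h'', e''⟩ := some_eq_some_of_eq hns (rfl : x₀ = x₀)
      (show (0 : AlgebraicClosure K) = W.toAffine.negY x₀ 0 by rw [negY_of_isTwoTorsionNF, neg_zero])
    exact e''
  rw [← hφ, hψ, h2]

/-! ## `ψ_*` kills the torsor classes, and the kernel identity -/

variable {V} in
/-- **`ψ_* ξ_d = 0`** for every `ψ` with `ψ ∘ φ_V = [2]` (in particular for the dual isogeny): the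
cocycle `σ ↦ χ_d(σ) T'` dies under `ψ` since `ψ(T') = O` (as `galH1Map_twoIsogenyTorsorClass` for
`φ_{V'}`). [cite: SilvermanAEC2009, Thm. X.4.2(a)] -/
theorem galH1Map_twoIsogenyTorsorClass_eq_zero_of_comp
    (ψ : V.twoIsogenyCodomain.geomPoints →+ V.geomPoints)
    (hψs : ∀ (σ : Field.absoluteGaloisGroup K) (P : V.twoIsogenyCodomain.geomPoints), ψ (σ • P) = σ • ψ P)
    (hψ : ∀ P : V.geomPoints, ψ (V.twoIsogenyGeomHom P) = 2 • P) {d : K} (hd : d ≠ 0) :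
    galH1Map ψ hψs (V.twoIsogenyCodomain.twoIsogenyTorsorClass hd) = 0 := by
  rw [twoIsogenyTorsorClass, galH1Map_oneCocycleClass, oneCocycleClass_eq_zero_iff]
  refine ⟨0, fun σ => ?_⟩
  rw [contOneCocycles.push_apply, twoIsogenyTorsorCocycle_apply]
  change ψ (V.twoIsogenyCodomain.twoIsogenyTorsorFun d σ) = σ • (0 : V.geomPoints) - 0
  rw [smul_zero, sub_zero, twoIsogenyTorsorFun]
  split_ifs
  · exact map_zero _
  · exact apply_geomTwoTorsionPoint_eq_zero_of_comp ψ hψ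

omit [CharZero K] in
/-- Congruence for `galH1Map` in its (propositionally equal) map argument. [folklore] -/
theorem galH1Map_congr_map {W₁ W₂ : WeierstrassCurve K} {f g : W₁.geomPoints →+ W₂.geomPoints}
    (hf : ∀ (σ : Field.absoluteGaloisGroup K) (P : W₁.geomPoints), f (σ • P) = σ • f P)
    (hg : ∀ (σ : Field.absoluteGaloisGroup K) (P : W₁.geomPoints), g (σ • P) = σ • g P)
    (h : f = g) (c : W₁.galH1) : galH1Map f hf c = galH1Map g hg c := by
  subst h
  rfl

variable {V} in
/-- **`ker ψ_* = ker (φ_{V'})_*` on `H¹(K, V')`** for every `Γ_K`-equivariant `ψ : V'(K̄) → V(K̄)` with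
`ψ ∘ φ_V = [2]` (the dual isogeny): `⊆` because `φ_{V'} = s ∘ ψ` (`twoIsogenyGeomHom_eq_scaleGeomHom_comp`,
functoriality of `H¹`), `⊇` because `ker (φ_{V'})_* = im Ξ_{V'}` (`range_twoIsogenyTorsorHom_eq_ker_galH1Map`)
and `ψ_* ξ_d = 0`. Silverman, *AEC*, III.6.1–6.2 with X.4.2(a). [folklore] -/
theorem ker_galH1Map_eq_of_comp_twoIsogeny
    (ψ : V.twoIsogenyCodomain.geomPoints →+ V.geomPoints)
    (hψs : ∀ (σ : Field.absoluteGaloisGroup K) (P : V.twoIsogenyCodomain.geomPoints), ψ (σ • P) = σ • ψ P)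
    (hψ : ∀ P : V.geomPoints, ψ (V.twoIsogenyGeomHom P) = 2 • P) :
    (galH1Map ψ hψs).ker =
      (galH1Map V.twoIsogenyCodomain.twoIsogenyGeomHom (twoIsogenyGeomHom_smul V.twoIsogenyCodomain)).ker := by
  ext c
  rw [AddMonoidHom.mem_ker, AddMonoidHom.mem_ker]
  constructor
  · intro hc
    obtain ⟨s, hs, hcomp⟩ := exists_twoIsogenyGeomHom_eq_comp ψ hψ
    rw [galH1Map_congr_map (twoIsogenyGeomHom_smul V.twoIsogenyCodomain)
      (fun σ P ↦ by simp [hψs, hs]) hcomp c,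
      ← galH1Map_galH1Map ψ hψs s hs c, hc, map_zero]
  · intro hc
    have hc' : c ∈ AddMonoidHom.range (G := Additive (SqUnits K)) V.twoIsogenyCodomain.twoIsogenyTorsorHom := by
      rw [range_twoIsogenyTorsorHom_eq_ker_galH1Map]; exact hc
    obtain ⟨x, rfl⟩ := hc'
    obtain ⟨w, hw⟩ := QuotientGroup.mk_surjective (Additive.toMul x)
    have hx : x = Additive.ofMul (sqClass (w : K)) := by
      rw [sqClass_of_ne_zero w.ne_zero, Units.mk0_val, hw]; rfl
    rw [hx, twoIsogenyTorsorHom_sqClass _ w.ne_zero]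
    exact galH1Map_twoIsogenyTorsorClass_eq_zero_of_comp ψ hψs hψ w.ne_zero

end Scale

/-! ## The kernel identity on `Ш` -/

section Sha

variable {K : Type u} [Field K] [NumberField K] (V : WeierstrassCurve K) [V.IsTwoTorsionNF] [V.IsElliptic]

variable {V} in
/-- **`ker Ш(ψ) = ker Ш(φ_{V'})`** over a number field, for every `Γ_K`-equivariant
`ψ : V'(K̄) → V(K̄)` with local points maps and `ψ ∘ φ_V = [2]` — in particular for the dual isogeny
`φ̂_V` — and any local points maps of `φ_{V'}` (e.g. `hasLocalPointsMaps_twoIsogeny`). With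
`natCard_sha_inf_range_twoIsogenyTorsorHom_eq` this identifies `#(Ш(V') ∩ im Ξ_{V'})` with
`#ker Ш(φ̂_V)`. Silverman, *AEC*, III.6.1–6.2 with X.4.2(a). [folklore] -/
theorem ker_shaMap_eq_of_comp_twoIsogeny
    (ψ : V.twoIsogenyCodomain.geomPoints →+ V.geomPoints)
    (hψs : ∀ (σ : Field.absoluteGaloisGroup K) (P : V.twoIsogenyCodomain.geomPoints), ψ (σ • P) = σ • ψ P)
    (hψ : ∀ P : V.geomPoints, ψ (V.twoIsogenyGeomHom P) = 2 • P)
    (hloc : HasLocalPointsMaps V.twoIsogenyCodomain V ψ)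
    (hloc' : HasLocalPointsMaps V.twoIsogenyCodomain V.twoIsogenyCodomain.twoIsogenyCodomain
      V.twoIsogenyCodomain.twoIsogenyGeomHom) :
    (shaMap ψ hψs hloc).ker =
      (shaMap V.twoIsogenyCodomain.twoIsogenyGeomHom (twoIsogenyGeomHom_smul V.twoIsogenyCodomain)
        hloc').ker := by
  have key := ker_galH1Map_eq_of_comp_twoIsogeny ψ hψs hψ
  ext c
  rw [AddMonoidHom.mem_ker, AddMonoidHom.mem_ker, ← Subtype.coe_inj, coe_shaMap_apply,
    ← Subtype.coe_inj (b := (0 : V.twoIsogenyCodomain.twoIsogenyCodomain.sha)), coe_shaMap_apply,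
    ZeroMemClass.coe_zero, ZeroMemClass.coe_zero, ← AddMonoidHom.mem_ker, ← AddMonoidHom.mem_ker, key]

end Sha

end WeierstrassCurve

end
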